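import Literature.Geometry.Lorentzian.TeukolskyBlowupPocketCoeff
import Literature.Geometry.Lorentzian.CarterThroatCoefficient
import Literature.Analysis.ODE.EulerZoneGrowth
import HarnessLib

/-!
# Transport of the scalar radial Teukolsky solution across the Euler zone of the blown-up chart,
# in the chart-free port `‖R r‖ + (r − r₊)‖R′ r‖`
(namespace `Literature.Geometry.Lorentzian.Kerr`.)

Companion of `TeukolskyBlowupPocketCoeff.lean`, `CarterThroatCoefficient.lean` and
`Literature/Analysis/ODE/EulerZoneGrowth.lean`. In the blown-up radius `x = (r − r₊)/d`,
`d = r₊ − r₋`, the scalar radial Teukolsky equation is `W″ = QW` for `W(x) = √(x(x+1))R(r₊ + dx)`,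
`Q = ((Λ − 2amω)x(x+1) − k² − ¼)/(x(x+1))²`, `k = ξ + ωx(2r₊ + dx)` (`radialK_blowup_div`; the
normal form enters as a HYPOTHESIS of the shape produced by the Summits-side
`stub_olverNormalForm`). On the EULER ZONE `x ≥ x₁ ≥ c·max(1, |ξ|)` the coefficient is of
inverse-square size, `x²|Q| ≤ 2Λ₁ + ¼ + 2/c² + 2G²` (`Kerr.throat_sq_mul_abs_coeff_le`,
`|Λ − 2amω| ≤ 2Λ ≤ 2Λ₁`, `|ω(2r₊ + dx)| ≤ G`), so the Euler amplitude `‖W‖ + x‖W′‖` grows at most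
like `(x_F/x₁)^{n+1}` (`Literature.Analysis.ODE.norm_add_mul_norm_deriv_le_of_euler`). This file
converts that statement into the CHART-FREE port

  `D(r) = ‖R r‖ + (r − r₊)‖R′(r)‖`  (`R′ = deriv R`),

by which the horizon pocket, the Euler zone and the far zone are glued in the polynomial sup
bound for the horizon-normalised solution (crux `KappaExplicitWaveDecay`, stub
`stub_horizonSupBoxPoly`):

* `hasDerivAt_blowup` — `W′(x) = S′(x)R(r) + S(x)·d·R′(r)`, `S = √(x(x+1))`, `S′ = (2x+1)/(2S)`;
* `deriv_sqrtWeight_mul` — `d/dr[√(r² + a²)R] = (r/√(r² + a²))R + √(r² + a²)R′`, with the norm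
  consequences `norm_deriv_le_of_sqrtWeight`, `norm_deriv_sqrtWeight_mul_le`;
* `port_le_blowup_amplitude`, `blowup_amplitude_le_port` — for `x > 0`, resp. `x ≥ c > 0`: `x·D(r) ≤ 2(‖W x‖ + x‖W′ x‖)` and `‖W x‖ + x‖W′ x‖ ≤ (2 + 2/c)·x·D(r)`;
* `euler_port_le` — THE TRANSPORT: for `c ≤ x₁`, `c|ξ| ≤ x₁`, `r₁ = r₊ + dx₁ ≤ R_F` and every
  `r ∈ [r₁, R_F]`: `D(r) ≤ 2(2 + 2/c)·2n·((R_F − r₊)/(dx₁))^{n+1}·D(r₁)`, whenever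
  `2Λ₁ + ¼ + 2/c² + 2(ω_M(4M + R_F))² ≤ n²` (`Λ ≤ Λ₁`, `|ω| ≤ ω_M`, `1 ≤ n`, `0 < c`).

Everything is proved; no named fact is used.

## References
* S. A. Teukolsky, W. H. Press, Astrophys. J. 193 (1974) 443–461, §II (the variable `x`).
* P. Hartman, *Ordinary Differential Equations* (SIAM 2002), Ch. IV §1 (a priori bounds).
  [Hartman2002]
-/

noncomputable section

namespace Literature.Geometry.Lorentzian

namespace Kerr

open Filter Set Complex
open scoped _root_.Topology

/-! ### The derivative of `W = √(x(x+1))R(r₊ + dx)` in terms of `R′` -/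

/-- **`W′ = S′R + S·d·R′`.** If `R` is differentiable at `r = r₊ + dx` (`x > 0`), then
`W(y) = √(y(y+1))R(r₊ + dy)` has derivative `((2x+1)/(2√(x(x+1))))R(r) + √(x(x+1))·(d·R′(r))`
at `x` (`R′ = deriv R`). [folklore] -/
theorem hasDerivAt_blowup {M a : ℝ} {R : ℝ → ℂ} {x : ℝ} (hx : 0 < x)
    (hR : DifferentiableAt ℝ R (rPlus M a + (rPlus M a - rMinus M a) * x)) :
    HasDerivAt (fun y : ℝ ↦ ((Real.sqrt (y * (y + 1)) : ℝ) : ℂ) *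
        R (rPlus M a + (rPlus M a - rMinus M a) * y))
      ((((2 * x + 1) / (2 * Real.sqrt (x * (x + 1))) : ℝ) : ℂ) *
          R (rPlus M a + (rPlus M a - rMinus M a) * x) +
        ((Real.sqrt (x * (x + 1)) : ℝ) : ℂ) *
          (((rPlus M a - rMinus M a : ℝ) : ℂ) *
            deriv R (rPlus M a + (rPlus M a - rMinus M a) * x))) x := by
  set d := rPlus M a - rMinus M a with hd_def
  have hθ : HasDerivAt (fun z : ℝ ↦ rPlus M a + d * z) d x := by
    simpa using ((hasDerivAt_id' x).const_mul d).const_add (rPlus M a)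
  have hF : HasDerivAt (fun z : ℝ ↦ R (rPlus M a + d * z)) ((d : ℂ) * deriv R (rPlus M a + d * x))
      x := by
    simpa [Function.comp_def, Complex.real_smul] using hR.hasDerivAt.scomp x hθ
  exact (hasDerivAt_sqrt_mul_add_one hx).ofReal_comp.mul hF

/-! ### The tortoise-type derivative `d/dr[√(r² + a²)R]` in terms of `R′` -/

-- adapted from Literature/Geometry/Lorentzian/TeukolskyHorizonNormalisedLimits.lean
/-- `d/ds (s² + a²)^{1/2} = s/(s² + a²)^{1/2}` at a point `y` with `y² + a² > 0`. [folklore] -/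
theorem hasDerivAt_sqrtWeight {a y : ℝ} (hy : 0 < y ^ 2 + a ^ 2) :
    HasDerivAt (fun s : ℝ ↦ Real.sqrt (s ^ 2 + a ^ 2)) (y / Real.sqrt (y ^ 2 + a ^ 2)) y := by
  have h1 : HasDerivAt (fun s : ℝ ↦ s ^ 2 + a ^ 2) (2 * y) y := by
    simpa using (hasDerivAt_pow 2 y).add_const (a ^ 2)
  refine (h1.sqrt hy.ne').congr_deriv ?_
  rw [mul_div_mul_left _ _ (two_ne_zero' ℝ)]

/-- **`d/dr[√(r² + a²)R] = (r/√(r² + a²))R + √(r² + a²)R′`** at a point `r` with `r² + a² > 0`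
where `R` is differentiable (`R′ = deriv R`). [folklore] -/
theorem deriv_sqrtWeight_mul {a r : ℝ} {R : ℝ → ℂ} (hA : 0 < r ^ 2 + a ^ 2)
    (hR : DifferentiableAt ℝ R r) :
    deriv (fun s : ℝ ↦ ((Real.sqrt (s ^ 2 + a ^ 2) : ℝ) : ℂ) * R s) r =
      (((r / Real.sqrt (r ^ 2 + a ^ 2)) : ℝ) : ℂ) * R r +
        ((Real.sqrt (r ^ 2 + a ^ 2) : ℝ) : ℂ) * deriv R r :=
  ((hasDerivAt_sqrtWeight hA).ofReal_comp.mul hR.hasDerivAt).deriv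

/-- `‖(r/√(r² + a²))·z‖ ≤ ‖z‖` (`|r| ≤ √(r² + a²)`). [folklore] -/
theorem norm_div_sqrtWeight_mul_le {a r : ℝ} (hA : 0 < r ^ 2 + a ^ 2) (z : ℂ) :
    ‖(((r / Real.sqrt (r ^ 2 + a ^ 2)) : ℝ) : ℂ) * z‖ ≤ ‖z‖ := by
  have hS : 0 < Real.sqrt (r ^ 2 + a ^ 2) := Real.sqrt_pos.2 hA
  rw [norm_mul, Complex.norm_real, Real.norm_eq_abs]
  have : |r / Real.sqrt (r ^ 2 + a ^ 2)| ≤ 1 := by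
    rw [abs_div, abs_of_pos hS, div_le_one hS]
    exact Real.abs_le_sqrt (by nlinarith [sq_nonneg a])
  exact mul_le_of_le_one_left (norm_nonneg _) this

/-- `‖R′ r‖·√(r² + a²) ≤ ‖(√(·² + a²)R)′ r‖ + ‖R r‖` (from `deriv_sqrtWeight_mul` and
`|r|/√(r² + a²) ≤ 1`). [folklore] -/
theorem norm_deriv_le_of_sqrtWeight {a r : ℝ} {R : ℝ → ℂ} (hA : 0 < r ^ 2 + a ^ 2)
    (hR : DifferentiableAt ℝ R r) :
    ‖deriv R r‖ * Real.sqrt (r ^ 2 + a ^ 2) ≤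
      ‖deriv (fun s : ℝ ↦ ((Real.sqrt (s ^ 2 + a ^ 2) : ℝ) : ℂ) * R s) r‖ + ‖R r‖ := by
  have hS : 0 < Real.sqrt (r ^ 2 + a ^ 2) := Real.sqrt_pos.2 hA
  rw [deriv_sqrtWeight_mul hA hR]
  set T₁ : ℂ := (((r / Real.sqrt (r ^ 2 + a ^ 2)) : ℝ) : ℂ) * R r with hT₁
  set T₂ : ℂ := ((Real.sqrt (r ^ 2 + a ^ 2) : ℝ) : ℂ) * deriv R r with hT₂
  have h1 : ‖T₁‖ ≤ ‖R r‖ := norm_div_sqrtWeight_mul_le hA (R r)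
  have h2 : ‖T₂‖ = ‖deriv R r‖ * Real.sqrt (r ^ 2 + a ^ 2) := by
    rw [hT₂, norm_mul, Complex.norm_of_nonneg hS.le, mul_comm]
  calc ‖deriv R r‖ * Real.sqrt (r ^ 2 + a ^ 2) = ‖(T₁ + T₂) - T₁‖ := by
        rw [add_sub_cancel_left, h2]
    _ ≤ ‖T₁ + T₂‖ + ‖T₁‖ := norm_sub_le _ _
    _ ≤ ‖T₁ + T₂‖ + ‖R r‖ := by linarith

/-- `‖(√(·² + a²)R)′ r‖ ≤ ‖R r‖ + √(r² + a²)‖R′ r‖`. [folklore] -/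
theorem norm_deriv_sqrtWeight_mul_le {a r : ℝ} {R : ℝ → ℂ} (hA : 0 < r ^ 2 + a ^ 2)
    (hR : DifferentiableAt ℝ R r) :
    ‖deriv (fun s : ℝ ↦ ((Real.sqrt (s ^ 2 + a ^ 2) : ℝ) : ℂ) * R s) r‖ ≤
      ‖R r‖ + Real.sqrt (r ^ 2 + a ^ 2) * ‖deriv R r‖ := by
  have hS : 0 < Real.sqrt (r ^ 2 + a ^ 2) := Real.sqrt_pos.2 hA
  rw [deriv_sqrtWeight_mul hA hR]
  calc _ ≤ ‖(((r / Real.sqrt (r ^ 2 + a ^ 2)) : ℝ) : ℂ) * R r‖ +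
        ‖((Real.sqrt (r ^ 2 + a ^ 2) : ℝ) : ℂ) * deriv R r‖ := norm_add_le _ _
    _ ≤ ‖R r‖ + Real.sqrt (r ^ 2 + a ^ 2) * ‖deriv R r‖ := by
        rw [norm_mul (((Real.sqrt (r ^ 2 + a ^ 2) : ℝ) : ℂ)), Complex.norm_of_nonneg hS.le]
        linarith [norm_div_sqrtWeight_mul_le hA (R r)]

/-! ### The Euler amplitude `‖W‖ + x‖W′‖` versus the port `‖R‖ + (r − r₊)‖R′‖` -/

/-- Elementary facts on `S = √(x(x+1))` for `x > 0`: `0 < S`, `S² = x(x+1)`, `x ≤ S`, `S ≤ x + 1`,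
and `x·(2x+1)/(2S) ≤ S`. [folklore] -/
theorem sqrt_mul_add_one_facts {x : ℝ} (hx : 0 < x) :
    0 < Real.sqrt (x * (x + 1)) ∧ Real.sqrt (x * (x + 1)) ^ 2 = x * (x + 1) ∧
      x ≤ Real.sqrt (x * (x + 1)) ∧ Real.sqrt (x * (x + 1)) ≤ x + 1 ∧
      x * ((2 * x + 1) / (2 * Real.sqrt (x * (x + 1)))) ≤ Real.sqrt (x * (x + 1)) := by
  set S := Real.sqrt (x * (x + 1)) with hS
  have hP : 0 < x * (x + 1) := by positivity
  have hS0 : 0 < S := Real.sqrt_pos.2 hP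
  have hS2 : S ^ 2 = x * (x + 1) := Real.sq_sqrt hP.le
  have h1 : x ≤ S := by nlinarith
  have h2 : S ≤ x + 1 := by nlinarith
  refine ⟨hS0, hS2, h1, h2, ?_⟩
  rw [mul_div_assoc', div_le_iff₀ (by positivity)]
  nlinarith

/-- **Port below the amplitude**: for `x > 0` and `r = r₊ + dx`,
`x·(‖R r‖ + dx·‖R′ r‖) ≤ 2·(‖S R r‖ + x‖S′R r + S·d·R′ r‖)` (`S = √(x(x+1)) ≥ x`,
`S d R′ = (S′R + SdR′) − S′R`, `xS′ ≤ S`). [folklore] -/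
theorem port_le_blowup_amplitude {x d : ℝ} (hx : 0 < x) (hd : 0 ≤ d) (R₀ R₁ : ℂ) :
    x * (‖R₀‖ + d * x * ‖R₁‖) ≤
      2 * (‖((Real.sqrt (x * (x + 1)) : ℝ) : ℂ) * R₀‖ +
        x * ‖((((2 * x + 1) / (2 * Real.sqrt (x * (x + 1)))) : ℝ) : ℂ) * R₀ +
          ((Real.sqrt (x * (x + 1)) : ℝ) : ℂ) * ((d : ℂ) * R₁)‖) := by
  obtain ⟨hS0, hS2, hxS, hS1, hxS'⟩ := sqrt_mul_add_one_facts hx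
  set S := Real.sqrt (x * (x + 1)) with hS
  set S' := (2 * x + 1) / (2 * S) with hS'
  have hS'0 : 0 ≤ S' := by positivity
  set A : ℂ := ((S' : ℝ) : ℂ) * R₀ with hA
  set B : ℂ := ((S : ℝ) : ℂ) * ((d : ℂ) * R₁) with hB
  have hnW : ‖((S : ℝ) : ℂ) * R₀‖ = S * ‖R₀‖ := by rw [norm_mul, Complex.norm_of_nonneg hS0.le]
  have hnA : ‖A‖ = S' * ‖R₀‖ := by rw [hA, norm_mul, Complex.norm_of_nonneg hS'0]
  have hnB : ‖B‖ = S * d * ‖R₁‖ := by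
    rw [hB, norm_mul, norm_mul, Complex.norm_of_nonneg hS0.le, Complex.norm_real,
      Real.norm_eq_abs, abs_of_nonneg hd, mul_assoc]
  have hB' : ‖B‖ ≤ ‖A + B‖ + ‖A‖ := by
    calc ‖B‖ = ‖(A + B) - A‖ := by rw [add_sub_cancel_left]
      _ ≤ ‖A + B‖ + ‖A‖ := norm_sub_le _ _
  rw [hnW]
  -- `x·dx‖R₁‖ ≤ x·‖B‖` (as `x ≤ S`) and `x‖A‖ = xS′‖R₀‖ ≤ S‖R₀‖`
  have h1 : x * (d * x * ‖R₁‖) ≤ x * ‖B‖ := by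
    rw [hnB]
    have : d * x * ‖R₁‖ ≤ S * d * ‖R₁‖ := by
      have h0 : 0 ≤ d * ‖R₁‖ := by positivity
      nlinarith
    exact mul_le_mul_of_nonneg_left this hx.le
  have h2 : x * ‖A‖ ≤ S * ‖R₀‖ := by
    rw [hnA, ← mul_assoc]
    exact mul_le_mul_of_nonneg_right hxS' (norm_nonneg _)
  have h3 : x * ‖R₀‖ ≤ S * ‖R₀‖ := mul_le_mul_of_nonneg_right hxS (norm_nonneg _)
  have h4 : 0 ≤ ‖A + B‖ := norm_nonneg _
  nlinarith [mul_le_mul_of_nonneg_left hB' hx.le]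

/-- **Amplitude below the port**: for `0 < c ≤ x` and `r = r₊ + dx`,
`‖S R r‖ + x‖S′R r + S·d·R′ r‖ ≤ (2 + 2/c)·x·(‖R r‖ + dx·‖R′ r‖)`
(`S ≤ x + 1 ≤ x(1 + 1/c)`, `S′ ≤ 1 + 1/(2c)`). [folklore] -/
theorem blowup_amplitude_le_port {x d c : ℝ} (hc : 0 < c) (hcx : c ≤ x) (hd : 0 ≤ d)
    (R₀ R₁ : ℂ) :
    ‖((Real.sqrt (x * (x + 1)) : ℝ) : ℂ) * R₀‖ +
        x * ‖((((2 * x + 1) / (2 * Real.sqrt (x * (x + 1)))) : ℝ) : ℂ) * R₀ +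
          ((Real.sqrt (x * (x + 1)) : ℝ) : ℂ) * ((d : ℂ) * R₁)‖ ≤
      (2 + 2 / c) * x * (‖R₀‖ + d * x * ‖R₁‖) := by
  have hx : 0 < x := hc.trans_le hcx
  obtain ⟨hS0, hS2, hxS, hS1, hxS'⟩ := sqrt_mul_add_one_facts hx
  set S := Real.sqrt (x * (x + 1)) with hS
  set S' := (2 * x + 1) / (2 * S) with hS'
  have hS'0 : 0 ≤ S' := by positivity
  have hnW : ‖((S : ℝ) : ℂ) * R₀‖ = S * ‖R₀‖ := by rw [norm_mul, Complex.norm_of_nonneg hS0.le]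
  have hnA : ‖((S' : ℝ) : ℂ) * R₀‖ = S' * ‖R₀‖ := by rw [norm_mul, Complex.norm_of_nonneg hS'0]
  have hnB : ‖((S : ℝ) : ℂ) * ((d : ℂ) * R₁)‖ = S * d * ‖R₁‖ := by
    rw [norm_mul, norm_mul, Complex.norm_of_nonneg hS0.le, Complex.norm_real,
      Real.norm_eq_abs, abs_of_nonneg hd, mul_assoc]
  have htri : ‖((S' : ℝ) : ℂ) * R₀ + ((S : ℝ) : ℂ) * ((d : ℂ) * R₁)‖ ≤ S' * ‖R₀‖ + S * d * ‖R₁‖ := by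
    rw [← hnA, ← hnB]; exact norm_add_le _ _
  -- `S ≤ x(1 + 1/c)`, `S′ ≤ 1 + 1/(2c)`, `xS′ ≤ S`
  have hxc : 1 ≤ x / c := by rwa [le_div_iff₀ hc, one_mul]
  have hSx : S ≤ (1 + 1 / c) * x := by
    have : x + 1 ≤ x + x / c := by linarith
    calc S ≤ x + 1 := hS1
      _ ≤ x + x / c := this
      _ = (1 + 1 / c) * x := by field_simp
  have hR0 : 0 ≤ ‖R₀‖ := norm_nonneg _
  have hR1 : 0 ≤ ‖R₁‖ := norm_nonneg _
  rw [hnW]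
  have h1 : S * ‖R₀‖ ≤ (1 + 1 / c) * x * ‖R₀‖ := mul_le_mul_of_nonneg_right hSx hR0
  have h2 : x * (S' * ‖R₀‖) ≤ S * ‖R₀‖ := by
    rw [← mul_assoc]; exact mul_le_mul_of_nonneg_right hxS' hR0
  have h3 : x * (S * d * ‖R₁‖) ≤ x * ((1 + 1 / c) * x * d * ‖R₁‖) := by
    apply mul_le_mul_of_nonneg_left _ hx.le
    have : 0 ≤ d * ‖R₁‖ := by positivity
    nlinarith
  have hc' : 0 < 1 / c := by positivity
  calc S * ‖R₀‖ + x * ‖((S' : ℝ) : ℂ) * R₀ + ((S : ℝ) : ℂ) * ((d : ℂ) * R₁)‖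
      ≤ S * ‖R₀‖ + x * (S' * ‖R₀‖ + S * d * ‖R₁‖) := by gcongr
    _ = S * ‖R₀‖ + x * (S' * ‖R₀‖) + x * (S * d * ‖R₁‖) := by ring
    _ ≤ (1 + 1 / c) * x * ‖R₀‖ + (1 + 1 / c) * x * ‖R₀‖ + x * ((1 + 1 / c) * x * d * ‖R₁‖) := by
        linarith
    _ = (2 + 2 / c) * x * ‖R₀‖ + (1 + 1 / c) * x * (d * x * ‖R₁‖) := by ring
    _ ≤ (2 + 2 / c) * x * ‖R₀‖ + (2 + 2 / c) * x * (d * x * ‖R₁‖) := by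
        have h0 : 0 ≤ x * (d * x * ‖R₁‖) := by positivity
        have h12 : (1 : ℝ) / c ≤ 2 / c := div_le_div_of_nonneg_right (by norm_num) hc.le
        have := mul_le_mul_of_nonneg_right (show (1 : ℝ) + 1 / c ≤ 2 + 2 / c by linarith) h0
        linarith
    _ = (2 + 2 / c) * x * (‖R₀‖ + d * x * ‖R₁‖) := by ring

/-! ### The transport across the Euler zone, in the port -/

/-- **Euler-zone transport of the port `D(r) = ‖R r‖ + (r − r₊)‖R′ r‖`.** Let `0 < M`, `|a| < M`,
`(ω, m, Λ)` admissible with `Λ ≤ Λ₁`, `|ω| ≤ ω_M`, `0 < c`, `R` differentiable on `r > r₊`,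
and let `W′, W″` be derivative witnesses of `W(y) = √(y(y+1))R(r₊ + dy)` on `y > 0` with `W″ = QW`
(the shape of `stub_olverNormalForm`). Let `n ≥ 1` with `2Λ₁ + ¼ + 2/c² + 2(ω_M(4M + R_F))² ≤ n²`.
If `c ≤ x₁`, `c|ξ| ≤ x₁` (`ξ = (2Mr₊/d)(ω − mω₊)`) and `r₁ := r₊ + dx₁ ≤ R_F`, then for every
`r ∈ [r₁, R_F]`:
`D(r) ≤ 2(2 + 2/c)·2n·((R_F − r₊)/(dx₁))^{n+1}·D(r₁)`
(`x²|Q| ≤ n²` on `[x₁, (R_F − r₊)/d]` by `Kerr.throat_sq_mul_abs_coeff_le`; Euler growth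
`Literature.Analysis.ODE.norm_add_mul_norm_deriv_le_of_euler`; the two port inequalities).
[cite: Hartman2002, Ch. IV §1, Lemma 1.1] -/
theorem euler_port_le {M a ω Λ c Λ₁ ωM RF : ℝ} {m : ℤ} (hM : 0 < M) (ha : |a| < M)
    (hadm : IsAdmissibleTriple a ω m Λ) (hΛ₁ : Λ ≤ Λ₁) (hωM : |ω| ≤ ωM) (hc0 : 0 < c)
    {R : ℝ → ℂ} (hRd : ∀ r, rPlus M a < r → DifferentiableAt ℝ R r)
    {W' W'' : ℝ → ℂ}
    (hW : ∀ x : ℝ, 0 < x →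
      HasDerivAt (fun y : ℝ ↦ ((Real.sqrt (y * (y + 1)) : ℝ) : ℂ) *
          R (rPlus M a + (rPlus M a - rMinus M a) * y)) (W' x) x ∧
        HasDerivAt W' (W'' x) x ∧
        W'' x =
          ((((Λ - 2 * a * m * ω) * (x * (x + 1)) -
                  (radialK a ω m (rPlus M a + (rPlus M a - rMinus M a) * x) /
                      (rPlus M a - rMinus M a)) ^ 2 - 1 / 4) /
                (x * (x + 1)) ^ 2 : ℝ) : ℂ) *
            (((Real.sqrt (x * (x + 1)) : ℝ) : ℂ) *
              R (rPlus M a + (rPlus M a - rMinus M a) * x)))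
    {n : ℕ} (hn1 : 1 ≤ n)
    (hn : 2 * Λ₁ + 1 / 4 + 2 / c ^ 2 + 2 * (ωM * (4 * M + RF)) ^ 2 ≤ (n : ℝ) ^ 2) {x₁ : ℝ}
    (hx₁c : c ≤ x₁)
    (hx₁ξ : c * |2 * M * rPlus M a / (rPlus M a - rMinus M a) *
        (ω - m * horizonAngularVelocity M a)| ≤ x₁)
    (hRF : rPlus M a + (rPlus M a - rMinus M a) * x₁ ≤ RF) {r : ℝ}
    (hr : r ∈ Icc (rPlus M a + (rPlus M a - rMinus M a) * x₁) RF) :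
    ‖R r‖ + (r - rPlus M a) * ‖deriv R r‖ ≤
      2 * (2 + 2 / c) * (2 * n * ((RF - rPlus M a) / ((rPlus M a - rMinus M a) * x₁)) ^ (n + 1)) *
        (‖R (rPlus M a + (rPlus M a - rMinus M a) * x₁)‖ +
          (rPlus M a - rMinus M a) * x₁ *
            ‖deriv R (rPlus M a + (rPlus M a - rMinus M a) * x₁)‖) := by
  set d := rPlus M a - rMinus M a with hd_def
  set rp := rPlus M a with hrp_def
  set ξ := 2 * M * rp / d * (ω - m * horizonAngularVelocity M a) with hξ_def
  have hd : 0 < d := sub_pos.2 (IsSubextremal.rMinus_lt_rPlus ha)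
  have hrp0 : 0 < rp := rPlus_pos hM a
  have hrp2 : rp ≤ 2 * M := rPlus_le_two_mul_self hM.le a
  have hx₁ : 0 < x₁ := hc0.trans_le hx₁c
  -- the Euler zone `[x₁, xF]` in the chart
  set xF := (RF - rp) / d with hxF_def
  have hx₁F : x₁ ≤ xF := by rw [hxF_def, le_div_iff₀ hd]; linarith
  set x := (r - rp) / d with hx_def
  have hrx : r = rp + d * x := by rw [hx_def]; field_simp; ring
  have hxI : x ∈ Icc x₁ xF := by
    constructor
    · rw [hx_def, le_div_iff₀ hd]; linarith [hr.1]
    · rw [hx_def, hxF_def]; exact div_le_div_of_nonneg_right (by linarith [hr.2]) hd.le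
  have hx0 : 0 < x := hx₁.trans_le hxI.1
  -- the coefficient
  set Q : ℝ → ℝ := fun y ↦ ((Λ - 2 * a * m * ω) * (y * (y + 1)) -
      (radialK a ω m (rp + d * y) / d) ^ 2 - 1 / 4) / (y * (y + 1)) ^ 2 with hQ_def
  have hy : ∀ z ∈ Icc x₁ xF, HasDerivAt (fun y : ℝ ↦ ((Real.sqrt (y * (y + 1)) : ℝ) : ℂ) *
      R (rp + d * y)) (W' z) z ∧ HasDerivAt W' ((fun s ↦ (Q s : ℂ)) z *
        (((Real.sqrt (z * (z + 1)) : ℝ) : ℂ) * R (rp + d * z))) z := by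
    intro z hz
    obtain ⟨h1, h2, h3⟩ := hW z (hx₁.trans_le hz.1)
    rw [h3] at h2
    exact ⟨h1, h2⟩
  have hΛ' : |Λ - 2 * a * m * ω| ≤ 2 * Λ₁ := by
    have h2 := hadm.2
    have hΛ0 := hadm.nonneg
    have : |2 * a * m * ω| = 2 * |a * m * ω| := by
      rw [show 2 * a * (m : ℝ) * ω = 2 * (a * m * ω) by ring, abs_mul, abs_two]
    calc |Λ - 2 * a * m * ω| ≤ |Λ| + |2 * a * m * ω| := abs_sub _ _
      _ ≤ Λ + Λ := by rw [abs_of_nonneg hΛ0, this]; linarith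
      _ ≤ 2 * Λ₁ := by linarith
  have hq : ∀ z ∈ Icc x₁ xF, z ^ 2 * ‖(fun s ↦ (Q s : ℂ)) z‖ ≤ (n : ℝ) ^ 2 := by
    intro z hz
    have hz0 : 0 < z := hx₁.trans_le hz.1
    have hcz : c * |ξ| ≤ z := hx₁ξ.trans hz.1
    have hdz : d * z ≤ RF - rp := by
      have := hz.2; rw [hxF_def, le_div_iff₀ hd] at this; linarith
    have hg : |ω * (2 * rp + d * z)| ≤ ωM * (4 * M + RF) := by
      rw [abs_mul, abs_of_pos (by positivity : 0 < 2 * rp + d * z)]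
      exact mul_le_mul hωM (by linarith) (by positivity) ((abs_nonneg ω).trans hωM)
    have hk : radialK a ω m (rp + d * z) / d = ξ + z * (ω * (2 * rp + d * z)) := by
      rw [hξ_def, hrp_def, hd_def, radialK_blowup_div hM ha ω m z]; ring
    simp only [Complex.norm_real, Real.norm_eq_abs, hQ_def, hk]
    exact (throat_sq_mul_abs_coeff_le hz0 hc0 hcz hΛ' hg).trans hn
  have key := Literature.Analysis.ODE.norm_add_mul_norm_deriv_le_of_euler hx₁ hn1 hy hq
    ⟨le_rfl, hx₁F⟩ hxI
  -- identify `W′` at `x` and `x₁` with `S′R + S d R′`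
  have hW'x := (hW x hx0).1.unique (hasDerivAt_blowup hx0 (hRd _ (by
    show rp < rp + d * x; linarith [mul_pos hd hx0])))
  have hW'x₁ := (hW x₁ hx₁).1.unique (hasDerivAt_blowup hx₁ (hRd _ (by
    show rp < rp + d * x₁; linarith [mul_pos hd hx₁])))
  rw [hW'x, hW'x₁] at key
  -- the two port inequalities
  have hlow := port_le_blowup_amplitude hx0 hd.le (R (rp + d * x)) (deriv R (rp + d * x))
  have hup := blowup_amplitude_le_port hc0 hx₁c hd.le (R (rp + d * x₁)) (deriv R (rp + d * x₁))
  -- assemble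
  set Gr := 2 * (n : ℝ) * (xF / x₁) ^ (n + 1) with hGr
  have hGr0 : 0 ≤ Gr := by
    have : 0 ≤ xF / x₁ := div_nonneg (hx₁.le.trans hx₁F) hx₁.le
    positivity
  have hD₁ : 0 ≤ ‖R (rp + d * x₁)‖ + d * x₁ * ‖deriv R (rp + d * x₁)‖ := by positivity
  have hchain : x * (‖R (rp + d * x)‖ + d * x * ‖deriv R (rp + d * x)‖) ≤
      2 * (Gr * ((2 + 2 / c) * x₁ * (‖R (rp + d * x₁)‖ + d * x₁ * ‖deriv R (rp + d * x₁)‖))) := by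
    calc _ ≤ _ := hlow
      _ ≤ 2 * (Gr * (‖((Real.sqrt (x₁ * (x₁ + 1)) : ℝ) : ℂ) * R (rp + d * x₁)‖ +
          x₁ * ‖((((2 * x₁ + 1) / (2 * Real.sqrt (x₁ * (x₁ + 1)))) : ℝ) : ℂ) * R (rp + d * x₁) +
            ((Real.sqrt (x₁ * (x₁ + 1)) : ℝ) : ℂ) * ((d : ℂ) * deriv R (rp + d * x₁))‖)) := by
          gcongr
      _ ≤ _ := by gcongr
  -- divide by `x ≥ x₁`
  have hfinal : ‖R (rp + d * x)‖ + d * x * ‖deriv R (rp + d * x)‖ ≤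
      2 * (2 + 2 / c) * Gr * (‖R (rp + d * x₁)‖ + d * x₁ * ‖deriv R (rp + d * x₁)‖) := by
    have h1 : x * (‖R (rp + d * x)‖ + d * x * ‖deriv R (rp + d * x)‖) ≤
        x * (2 * (2 + 2 / c) * Gr * (‖R (rp + d * x₁)‖ + d * x₁ * ‖deriv R (rp + d * x₁)‖)) := by
      calc _ ≤ _ := hchain
        _ = x₁ * (2 * (2 + 2 / c) * Gr *
            (‖R (rp + d * x₁)‖ + d * x₁ * ‖deriv R (rp + d * x₁)‖)) := by ring
        _ ≤ x * (2 * (2 + 2 / c) * Gr *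
            (‖R (rp + d * x₁)‖ + d * x₁ * ‖deriv R (rp + d * x₁)‖)) := by
            apply mul_le_mul_of_nonneg_right hxI.1
            have : 0 ≤ 2 + 2 / c := by positivity
            positivity
    exact le_of_mul_le_mul_left h1 hx0
  have hrx' : r - rp = d * x := by rw [hrx]; ring
  rw [hrx', hrx]
  simpa only [hGr, hxF_def, div_div] using hfinal

end Kerr

end Literature.Geometry.Lorentzian

end
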